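import Summits.ResolutionOfSingularities.ResolutionOfSingularities.Theorems.WeightedInvariantHypersurfaceLocalGameEFT4SDimLE
import Summits.ResolutionOfSingularities.ResolutionOfSingularities.Theorems.WeightedInvariantIota3Sigma
import Summits.ResolutionOfSingularities.ResolutionOfSingularities.Theorems.WeightedInvariantIota3Eps
import Summits.ResolutionOfSingularities.ResolutionOfSingularities.Theorems.WeightedInvariantContactCylinderIota
import HarnessLib

/-!
# (P3b-drop) — THE STATEMENT: at a TAME ISOLATED top point of Krull dimension ≤ 3 the exact-flag-weight centre makes `ι` drop
# (door `HypersurfaceCentreConstruction`, stmt-ResolutionOfSingularities-19897; KEY `stub_localWeightedDropEFT4S`; P3 rung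
# `stub_keyRung_dimLEThree` of skeleton v3.7 / ladder `PRung d` p522114; ORDER (o33-b) of res-L1-w43-plan-1, IOTA3-DESIGN v1/v1.1 §3 P3b / §5;
# typer res-type-061)

Topic: `Summits/ResolutionOfSingularities/ResolutionOfSingularities/Theorems`. STATEMENT MODULE (definitions of `Prop`s + trivial seams; NO proof
of the statement): the regime-P3b piece of the (drop) conjunct of `CanonicalGameClauseLE 3 p ι J` (`…HypersurfaceLocalGameEFT4SDimLE`), cut
out as a named, PARAMETRIC target.

* `WeightedDrop ι S f P u w` — the (drop) conjunct of `CanonicalGameClause` / `CanonicalGameClauseLE d` NAMED, body verbatim: after the weighted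
  blow-up of the centre presented by `(u, w)` over `P`, at every point `𝔫` of the cobordant blow-up on the exceptional divisor, over `P`, off
  the vertex, where the strict transform `g` of `f` is still singular (`g/1 ∈ 𝔪_𝔫²`), the invariant drops: `ι (B_𝔫) g < ι S f`.
* `Iota3.IsSigmaMaximiser f ν g₁ g₂ q r₁ r₂` — «`(g₁, g₂; q, r₁, r₂)` is a σ-ATTAINING two-flag of `f`»: an admissible triple reached along the
  two-flag `(g₁, g₂)` whose ratio `r₁/r₂` and then level `r₁/q` are lexicographically MAXIMAL among all admissible reached triples (073's
  letters `sigmaRatioNat` / `sigmaLevelNat` of ORDER (o32-ι-b) are the scaled sups of exactly these quantities; stated here by cross-multiplication,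
  scale-free).
* **`P3bDropOf Tame ι p`** — for every position `S` (regular local, essentially of finite type over a perfect field of characteristic `p`,
  Krull dimension ≤ 3), every `0 ≠ f ∈ 𝔪²` whose EQUIMULTIPLE LOCUS IS THE CLOSED POINT (`topStratum iotaOrd S f = {𝔪}`: ε = 0, isolated) and
  which is `Tame`, and every σ-attaining two-flag `(g₁, g₂; q, r₁, r₂)` completed to a regular system of parameters `(x, g₂, g₁)` of `S`
  (`dim S = 3`), with PRIMITIVE weights: `WeightedDrop ι S f 𝔪 ![x, g₂, g₁] ![q, r₂, r₁]` — «the EXACT-flag-weight centre satisfies (drop)».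
  PARAMETRIC in the tameness cut `Tame` (IOTA3-DESIGN v1 §3 P3b lists two candidates (t1)/(t2); v1.1's P3c-H hybrid switches on it) and in the
  full invariant `ι` (of record: `iotaFlat := iotaLex _ Iota3.iotaOrdEps (ContactCylinder.iotaCylinder Iota3.iotaOrdEps Iota3.iotaSigma)`, this file;
  memo §2.3; the letter files are 013's p527087, 073's (o32-ι-b), 061's p527951).
* Seams (sorry-free, trivial): `weightedDrop_iff` (the named conjunct IS the clause text), `P3bDropOf.mono_tame` (a stronger tameness cut gives a
  weaker statement), `P3bDropOf.drop` (modus ponens at a position).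

WHY IT MIGHT HOLD: it is the Abramovich–Temkin–Włodarczyk drop theorem («after the weighted blow-up of the centre `(x₁^{a₁}, …, xₙ^{aₙ})` the
invariant drops at every point of the blow-up», [ATW2024, Thm. 5.3.1 / 6.2.1] as cited in `Literature/Barriers/…/WeightedPPinchLoop.lean`)
transplanted to TAME positions of Krull dimension 3 in characteristic `p`, where the successive Tschirnhaus/derivative steps that ATW use to
find maximal contact are available level by level.  WHY IT MIGHT FAIL: the tree's barrier `WeightedPPinchLoop` (a μ_p-stabiliser successor
point re-creates the pinch) bites exactly when `p` divides a normalised weight — the tameness cut must exclude it; and σ is a sup over ALL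
flags, attained or not (res-type-073 IOTA3-PROBE §3 (4)).  NOTHING of this is proved here.

[OURS · candidates · conjecture-grade statement of OUR key's rung; nothing here asserts anything about Hironaka's problem; NOT a statement of
the manuscript under review (Hironaka 2017, [claim: Hironaka2017, status: under-review]); AI typing, weaker than expert review.]

## References
* D. Abramovich, M. Temkin, J. Włodarczyk, *Functorial embedded resolution via weighted blowings up*, Algebra & Number Theory 18 (2024). [ATW2024]
* res-L1-w43-plan-1, `L/res-L1-w43-plan-1/IOTA3-DESIGN.md` v1/v1.1 (OURS, AI planning); res-type-073 IOTA3-PROBE v1.1; res-type-078 IOTA3-INPUT v1.1.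
-/

noncomputable section

open IsLocalRing Literature.AlgebraicGeometry.Resolution
open Summit.ResolutionOfSingularities.ResolutionOfSingularities.Theorems

set_option linter.dupNamespace false -- mandated namespace of this single-conjunct summit

namespace Summit.ResolutionOfSingularities.ResolutionOfSingularities.Cruxes.HypersurfaceCentreConstruction.LocalEngine

/-! ## The (drop) conjunct, named -/

/-- [OURS · (o33-b)] **The (drop) conjunct of `CanonicalGameClause(LE)` for the centre presented by `(u, w)` over `P`**, body verbatim:
at every prime `𝔫` of the cobordant algebra `B = cobordantAlgebra' u w` containing the exceptional parameter `T'`, lying over `P`, NOT containing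
the vertex ideal, and every factorisation `f = T'^a · g` with `T' ∤ g` and `g/1 ∈ 𝔪_𝔫²` (the strict transform is still singular at `𝔫`):
`ι (B_𝔫) (g/1) < ι S f`.  A predicate of the line (the clause text, named), not a cited statement. -/
def WeightedDrop (ι : (R : Type) → [CommRing R] → R → Ordinal.{0}) (S : Type) [CommRing S] (f : S) (P : Ideal S) {n : ℕ}
    (u : Fin n → S) (w : Fin n → ℕ) : Prop :=
  ∀ (𝔫 : Ideal (cobordantAlgebra' u w)) [𝔫.IsPrime],
    cobordantT' u w ∈ 𝔫 →
    P.map (algebraMap S (cobordantAlgebra' u w)) ≤ 𝔫 →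
    ¬ (extReesAlgebra.vertexIdeal (weightedMonomialIdeal u w) ≤ 𝔫) →
    ∀ (a : ℕ) (g : cobordantAlgebra' u w),
      algebraMap S (cobordantAlgebra' u w) f = cobordantT' u w ^ a * g →
      ¬ (cobordantT' u w ∣ g) →
      algebraMap (cobordantAlgebra' u w) (Localization.AtPrime 𝔫) g ∈
        (maximalIdeal (Localization.AtPrime 𝔫)) ^ 2 →
      ι (Localization.AtPrime 𝔫) (algebraMap (cobordantAlgebra' u w) (Localization.AtPrime 𝔫) g) < ι S f

/-- `WeightedDrop` unfolded (the clause text). [folklore] -/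
theorem weightedDrop_iff (ι : (R : Type) → [CommRing R] → R → Ordinal.{0}) (S : Type) [CommRing S] (f : S) (P : Ideal S) {n : ℕ}
    (u : Fin n → S) (w : Fin n → ℕ) :
    WeightedDrop ι S f P u w ↔
      ∀ (𝔫 : Ideal (cobordantAlgebra' u w)) [𝔫.IsPrime],
        cobordantT' u w ∈ 𝔫 →
        P.map (algebraMap S (cobordantAlgebra' u w)) ≤ 𝔫 →
        ¬ (extReesAlgebra.vertexIdeal (weightedMonomialIdeal u w) ≤ 𝔫) →
        ∀ (a : ℕ) (g : cobordantAlgebra' u w),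
          algebraMap S (cobordantAlgebra' u w) f = cobordantT' u w ^ a * g →
          ¬ (cobordantT' u w ∣ g) →
          algebraMap (cobordantAlgebra' u w) (Localization.AtPrime 𝔫) g ∈
            (maximalIdeal (Localization.AtPrime 𝔫)) ^ 2 →
          ι (Localization.AtPrime 𝔫) (algebraMap (cobordantAlgebra' u w) (Localization.AtPrime 𝔫) g) < ι S f :=
  Iff.rfl

/-- **Monotonicity of the named (drop) conjunct in the invariant**: a drop for `ι` at `(S, f)` is inherited by any `ι'` that is bounded
above by `ι` on the successor rings and below by `ι` at `(S, f)` (`ι S f ≤ ι' S f`). [folklore] -/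
theorem WeightedDrop.mono {ι ι' : (R : Type) → [CommRing R] → R → Ordinal.{0}} {S : Type} [CommRing S] {f : S} {P : Ideal S} {n : ℕ}
    {u : Fin n → S} {w : Fin n → ℕ} (h : WeightedDrop ι S f P u w)
    (hle : ∀ (𝔫 : Ideal (cobordantAlgebra' u w)) [𝔫.IsPrime] (g : cobordantAlgebra' u w),
      ι' (Localization.AtPrime 𝔫) (algebraMap (cobordantAlgebra' u w) (Localization.AtPrime 𝔫) g) ≤
        ι (Localization.AtPrime 𝔫) (algebraMap (cobordantAlgebra' u w) (Localization.AtPrime 𝔫) g))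
    (heq : ι S f ≤ ι' S f) : WeightedDrop ι' S f P u w :=
  fun 𝔫 _ hT hP hv a g hfac hndvd hsing => (hle 𝔫 g).trans_lt ((h 𝔫 hT hP hv a g hfac hndvd hsing).trans_le heq)

namespace Iota3

/-! ## σ-attaining two-flags -/

variable {S : Type} [CommRing S]

/-- [OURS · (o33-b)] **`(g₁, g₂; q, r₁, r₂)` is a σ-ATTAINING two-flag of `f` (of order `ν`)**: `(q; r₁, r₂)` is admissible, the two-flag
`(g₁, g₂)` carries `f` to level `r₁ν` of its `(q; r₁, r₂)`-filtration, and among ALL admissible triples reached by `f` (along any two-flag)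
the pair (ratio `r₁/r₂`, level `r₁/q`) is lexicographically maximal — cross-multiplied, scale-free (073's `sigmaRatioNat` / `sigmaLevelNat` are
the scaled sups of these two quantities).  A predicate of the line, not a cited statement. -/
def IsSigmaMaximiser [IsLocalRing S] (f : S) (ν : ℕ) (g₁ g₂ : S) (q r₁ r₂ : ℕ) : Prop :=
  AdmissibleTriple q r₁ r₂ ∧ IsTwoFlag g₁ g₂ ∧ f ∈ flagContactFiltration g₁ g₂ q r₁ r₂ (r₁ * ν) ∧
    ∀ q' r₁' r₂' : ℕ, AdmissibleTriple q' r₁' r₂' → FlagReaches f ν q' r₁' r₂' →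
      r₁' * r₂ < r₁ * r₂' ∨ (r₁' * r₂ = r₁ * r₂' ∧ r₁' * q ≤ r₁ * q')

/-- A σ-attaining two-flag reaches its own triple. [folklore] -/
theorem IsSigmaMaximiser.flagReaches [IsLocalRing S] {f : S} {ν : ℕ} {g₁ g₂ : S} {q r₁ r₂ : ℕ}
    (h : IsSigmaMaximiser f ν g₁ g₂ q r₁ r₂) : FlagReaches f ν q r₁ r₂ :=
  ⟨g₁, g₂, h.2.1, h.2.2.1⟩

/-- The weights of an admissible triple are positive. [folklore] -/
theorem AdmissibleTriple.pos {q r₁ r₂ : ℕ} (h : AdmissibleTriple q r₁ r₂) : 0 < q ∧ 0 < r₂ ∧ 0 < r₁ :=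
  ⟨h.1, h.1.trans_le h.2.1, (h.1.trans_le h.2.1).trans_le h.2.2⟩

/-! ## The statement (P3b-drop), parametric in the tameness cut and in the invariant -/

/-- [OURS · (o33-b) · candidate · conjecture-grade] **(P3b-drop) for the tameness cut `Tame` and the invariant `ι`.**  At every position `S`
(regular local, essentially of finite type over a perfect field `k₀` of characteristic `p`, Krull dimension `≤ 3`) and every `f ≠ 0`,
`f ∈ 𝔪²`, such that
* the EQUIMULTIPLE LOCUS of `f` is the closed point (`topStratum iotaOrd S f = {𝔮 | 𝔪 ≤ 𝔮}` — an ISOLATED top point, `ε = 0`),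
* the position is `Tame S f`,
and for every σ-attaining two-flag `(g₁, g₂; q, r₁, r₂)` of `f` (order `ν = iotaOrd S f`) completed by `x` to a regular system of parameters
`(x, g₂, g₁)` of `S` (so `dim S = 3`) with PRIMITIVE weight vector `(q, r₂, r₁)`: the weighted blow-up of the centre `𝔪` presented by
`u = (x, g₂, g₁)`, `w = (q, r₂, r₁)` satisfies the (drop) conjunct for `ι` — `WeightedDrop ι S f 𝔪 ![x, g₂, g₁] ![q, r₂, r₁]`.
Of record (IOTA3-DESIGN v1 §3 P3b): `ι := iotaFlat` (the P3 invariant `(ν ; ε ; σ)` with generic reading), `Tame :=` the cut (t1)/(t2) the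
planner fixes.  NOT in print as a theorem in characteristic `p`; the ATW drop theorem transplanted. -/
def P3bDropOf (Tame : (R : Type) → [CommRing R] → R → Prop) (ι : (R : Type) → [CommRing R] → R → Ordinal.{0}) (p : ℕ) : Prop :=
  ∀ (k₀ : Type) [Field k₀] [CharP k₀ p] [PerfectField k₀]
    (S : Type) [CommRing S] [Algebra k₀ S] [Algebra.EssFiniteType k₀ S] [IsRegularLocalRing S] (f : S),
    ringKrullDim S ≤ 3 → f ≠ 0 → f ∈ (maximalIdeal S) ^ 2 →
    ContactCylinder.topStratum iotaOrd S f = {𝔮 | maximalIdeal S ≤ 𝔮.asIdeal} →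
    Tame S f →
    ∀ (ν : ℕ), iotaOrd S f = ν →
    ∀ (x g₁ g₂ : S) (q r₁ r₂ : ℕ),
      Ideal.span {x, g₂, g₁} = maximalIdeal S → (maximalIdeal S).spanFinrank = 3 →
      IsSigmaMaximiser f ν g₁ g₂ q r₁ r₂ →
      (∀ d : ℕ, d ∣ q → d ∣ r₁ → d ∣ r₂ → d = 1) →
      WeightedDrop ι S f (maximalIdeal S) ![x, g₂, g₁] ![q, r₂, r₁]

/-- A STRONGER tameness cut gives a WEAKER (P3b-drop): `(∀ S f, Tame' S f → Tame S f) → P3bDropOf Tame ι p → P3bDropOf Tame' ι p`.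
[folklore] -/
theorem P3bDropOf.mono_tame {Tame Tame' : (R : Type) → [CommRing R] → R → Prop}
    (hT : ∀ (R : Type) [CommRing R] (g : R), Tame' R g → Tame R g) {ι : (R : Type) → [CommRing R] → R → Ordinal.{0}} {p : ℕ}
    (h : P3bDropOf Tame ι p) : P3bDropOf Tame' ι p :=
  fun k₀ _ _ _ S _ _ _ _ f hdim hf0 hf2 hiso htame ν hν x g₁ g₂ q r₁ r₂ hspan hrk hmax hprim =>
    h k₀ S f hdim hf0 hf2 hiso (hT S f htame) ν hν x g₁ g₂ q r₁ r₂ hspan hrk hmax hprim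

/-- Modus ponens at a position: (P3b-drop) gives the (drop) conjunct text for the exact-flag-weight centre at a tame isolated point.
[folklore] -/
theorem P3bDropOf.drop {Tame : (R : Type) → [CommRing R] → R → Prop} {ι : (R : Type) → [CommRing R] → R → Ordinal.{0}} {p : ℕ}
    (h : P3bDropOf Tame ι p) (k₀ : Type) [Field k₀] [CharP k₀ p] [PerfectField k₀]
    (S : Type) [CommRing S] [Algebra k₀ S] [Algebra.EssFiniteType k₀ S] [IsRegularLocalRing S] (f : S)
    (hdim : ringKrullDim S ≤ 3) (hf0 : f ≠ 0) (hf2 : f ∈ (maximalIdeal S) ^ 2)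
    (hiso : ContactCylinder.topStratum iotaOrd S f = {𝔮 | maximalIdeal S ≤ 𝔮.asIdeal}) (htame : Tame S f)
    {ν : ℕ} (hν : iotaOrd S f = ν) {x g₁ g₂ : S} {q r₁ r₂ : ℕ}
    (hspan : Ideal.span {x, g₂, g₁} = maximalIdeal S) (hrk : (maximalIdeal S).spanFinrank = 3)
    (hmax : IsSigmaMaximiser f ν g₁ g₂ q r₁ r₂) (hprim : ∀ d : ℕ, d ∣ q → d ∣ r₁ → d ∣ r₂ → d = 1) :
    WeightedDrop ι S f (maximalIdeal S) ![x, g₂, g₁] ![q, r₂, r₁] :=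
  h k₀ S f hdim hf0 hf2 hiso htame ν hν x g₁ g₂ q r₁ r₂ hspan hrk hmax hprim

/-! ## The invariant and the statement of record (IOTA3-DESIGN v1 §2.3 / §3 P3b) -/

/-- [OURS · IOTA3-DESIGN v1 §2.3] **The P3 invariant with GENERIC READING**: `iotaFlat := (ν ; ε ; σ)` where the σ-block is read at the
generic point of the top `(ν, ε)`-stratum (061's `ContactCylinder.iotaCylinder`, p527951) — pointwise at isolated top points, transversally
along a permissible equimultiple curve.  `= iotaLex ((ω+1)·ω) iotaOrdEps (iotaCylinder iotaOrdEps iotaSigma)`.  (The POINTWISE nesting is the term `Iota3.iotaFlatOf Iota3.iotaOrdEps` (res-type-073, p528355) — no cylinder; the two agree at isolated top points by `iotaCylinder_eq_self_of_topStratum_eq_closedPoint`, not in general; res-type-073 11:50:47Z: «ONE `iotaFlat`, generic reading».) -/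
def iotaFlat : (R : Type) → [CommRing R] → R → Ordinal.{0} :=
  iotaLex ((Ordinal.omega0 + 1) * Ordinal.omega0) iotaOrdEps (ContactCylinder.iotaCylinder iotaOrdEps iotaSigma)

/-- (c6) for `iotaFlat`: iso-invariance, by the transfer kit (`iotaLex_isoInvariant`), 013's `iotaOrdEps_isoInvariant`, 061's
`iotaCylinder_isoInvariant`, 073's `iotaSigma_isoInvariant`. [OURS · L1 W4.3] -/
theorem iotaFlat_isoInvariant : IotaIsoInvariant iotaFlat :=
  iotaLex_isoInvariant iotaOrdEps_isoInvariant
    (ContactCylinder.iotaCylinder_isoInvariant _ _ iotaOrdEps_isoInvariant iotaSigma_isoInvariant)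

/-- (c12a) for `iotaFlat`: unit-invariance, likewise. [OURS · L1 W4.3] -/
theorem iotaFlat_unitInvariant : IotaUnitInvariant iotaFlat :=
  iotaLex_unitInvariant iotaOrdEps_unitInvariant
    (ContactCylinder.iotaCylinder_unitInvariant _ _ iotaOrdEps_unitInvariant iotaSigma_unitInvariant)

/-- A cylinder reading is bounded by the bound of the letter it reads (its values are values of `ι`). [folklore] -/
theorem _root_.Summit.ResolutionOfSingularities.ResolutionOfSingularities.Theorems.ContactCylinder.iotaCylinder_boundedBy
    {Λ : Ordinal.{0}} (ι₀ ι : (R : Type) → [CommRing R] → R → Ordinal.{0}) (h : IotaBoundedBy Λ ι) :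
    IotaBoundedBy Λ (ContactCylinder.iotaCylinder ι₀ ι) := by
  intro R _ g
  by_cases hP : (ContactCylinder.topStratumPrime ι₀ R g).IsPrime
  · rw [ContactCylinder.iotaCylinder_eq_iotaAtPrime ι₀ ι R g, ContactCylinder.iotaAtPrime_def]
    exact h _ _
  · rw [ContactCylinder.iotaCylinder_of_not_isPrime ι₀ ι R g hP]
    exact h R g

/-- `iotaFlat < ((ω+1)·ω) · (ω·(ω+1))` (bound for further nestings / well-foundedness bookkeeping). [OURS · L1 W4.3] -/
theorem iotaFlat_boundedBy :
    IotaBoundedBy ((Ordinal.omega0 + 1) * Ordinal.omega0 * (Ordinal.omega0 * (Ordinal.omega0 + 1))) iotaFlat :=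
  iotaLex_boundedBy iotaOrdEps_boundedBy (ContactCylinder.iotaCylinder_boundedBy _ _ iotaSigma_boundedBy)

/-- (strat)/(drop) currency for `iotaFlat`: it drops iff `(ν, ε)` drops, or `(ν, ε)` ties and the generically-read `σ` drops
(`iotaLex_lt_iff`). [OURS · L1 W4.3] -/
theorem iotaFlat_lt_iff (R : Type) [CommRing R] (g : R) (R' : Type) [CommRing R'] (g' : R') :
    iotaFlat R g < iotaFlat R' g' ↔
      iotaOrdEps R g < iotaOrdEps R' g' ∨
        (iotaOrdEps R g = iotaOrdEps R' g' ∧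
          ContactCylinder.iotaCylinder iotaOrdEps iotaSigma R g < ContactCylinder.iotaCylinder iotaOrdEps iotaSigma R' g') :=
  iotaLex_lt_iff (ContactCylinder.iotaCylinder_boundedBy _ _ iotaSigma_boundedBy) R g R' g'

/-- [OURS · (o33-b) · candidate] **(P3b-drop) OF RECORD, parametric only in the tameness cut**: `P3bDrop Tame p := P3bDropOf Tame iotaFlat p`.
The cut (t1) «no successive initial form along a σ-attaining flag is a `p`-th power» / (t2) «`p` divides none of the normalised weights» is the
planner's to fix (IOTA3-DESIGN v1 §3 P3b; v1.1 P3c-H switches on it). -/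
def P3bDrop (Tame : (R : Type) → [CommRing R] → R → Prop) (p : ℕ) : Prop :=
  P3bDropOf Tame iotaFlat p

/-- [OURS · (o33-b) · candidate cut (t2)] **Weight-tameness of a position**: `p` divides NONE of the primitive weights `(q, r₂, r₁)` of ANY
σ-attaining two-flag of `f` (no μ_p-stabiliser point on the weighted blow-up — the hypothesis under which the tree's barrier `WeightedPPinchLoop`
is silent; IOTA3-DESIGN v1 §3 P3b (t2)). -/
def WeightTame (p : ℕ) (R : Type) [CommRing R] (f : R) : Prop :=
  ∀ [IsLocalRing R] (ν : ℕ), iotaOrd R f = ν → ∀ (g₁ g₂ : R) (q r₁ r₂ : ℕ),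
    IsSigmaMaximiser f ν g₁ g₂ q r₁ r₂ → (∀ d : ℕ, d ∣ q → d ∣ r₁ → d ∣ r₂ → d = 1) →
    ¬ p ∣ q ∧ ¬ p ∣ r₁ ∧ ¬ p ∣ r₂

/-- [OURS · (o33-b) · candidate] (P3b-drop) under the weight-tameness cut (t2). -/
def P3bDropWeightTame (p : ℕ) : Prop :=
  P3bDrop (WeightTame p) p

end Iota3

end Summit.ResolutionOfSingularities.ResolutionOfSingularities.Cruxes.HypersurfaceCentreConstruction.LocalEngine

end
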